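import Summits.RiemannHypothesis.RiemannHypothesis.Theorems.UniversalFactorH0DecayStandalone
import Literature.NumberTheory.LFunctions.XiIntegralLimitProofs
import Literature.NumberTheory.LFunctions.DeBruijnPhiTheta

/-!
# RiemannHypothesis / UniversalFactor — the complex continuation `Φ_ℂ` of the Pólya–de Bruijn kernel
and Fourier inversion on the real axis (negative-side support for crux `LaplaceLoophole`, item stmt-RiemannHypothesis-2575)

First of two files making the residue `C(a) = ∫₀^∞ H_0(x) cosh(ax) dx` of the wide window
(hypothesis of `wideKernelNoGo`, case split of `ExceptionalWideNoGo`) computable: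

* `UniversalFactor.deBruijnPhiC` — `Φ_ℂ(u) = Σ_{n≥1} (2π²n⁴e^{9u} − 3πn²e^{5u}) exp(−πn²e^{4u})`, equal to
  `deBruijnPhi` on `ℝ` (`deBruijnPhiC_ofReal`) and analytic on the strip `|Im u| < π/8`
  (`analyticOnNhd_deBruijnPhiC`; Weierstrass M-test on rectangles,
  `Complex.differentiableOn_tsum_of_summable_norm`);
* `UniversalFactor.integral_Ioi_deBruijnH_zero_mul_cos` — Fourier inversion at real frequencies,
  `∫₀^∞ H_0(x) cos(tx) dx = (π/2)Φ(t)` (Mathlib's `Continuous.fourierInv_fourier_eq` and the tree's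
  `fourier_deBruijnPhi`; `Φ`, `H_0` even).

The sequel `LaplaceLoopholeResidueSeries.lean` proves `C(a) = (π/2)Φ_ℂ(ia)` (`|a| < π/8`) by the
identity theorem.
-/

noncomputable section

namespace Summit.RiemannHypothesis.RiemannHypothesis.Theorems

open MeasureTheory Set Filter Complex Real
open scoped Topology FourierTransform
open Literature.NumberTheory.LFunctions

/-! ## The complex continuation `Φ_ℂ` of the kernel -/

/-- The `n`-th summand of `Φ` continued to complex `u` (index shifted: term `n + 1`). [folklore] -/
def UniversalFactor.deBruijnPhiSummandC (n : ℕ) (u : ℂ) : ℂ :=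
  (2 * π ^ 2 * ((n : ℂ) + 1) ^ 4 * cexp (9 * u) - 3 * π * ((n : ℂ) + 1) ^ 2 * cexp (5 * u)) *
    cexp (-(π * ((n : ℂ) + 1) ^ 2 * cexp (4 * u)))

/-- The complex continuation `Φ_ℂ(u) = Σ_{n≥1} (2π²n⁴e^{9u} − 3πn²e^{5u}) exp(−πn²e^{4u})` of the
Pólya–de Bruijn kernel (converges for `|Im u| < π/8`). [folklore] -/
def UniversalFactor.deBruijnPhiC (u : ℂ) : ℂ :=
  ∑' n : ℕ, UniversalFactor.deBruijnPhiSummandC n u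

/-- On the real axis the complex summand is the real one. [folklore] -/
theorem UniversalFactor.deBruijnPhiSummandC_ofReal (n : ℕ) (t : ℝ) :
    UniversalFactor.deBruijnPhiSummandC n (t : ℂ) = (deBruijnPhiSummand n t : ℂ) := by
  unfold UniversalFactor.deBruijnPhiSummandC deBruijnPhiSummand
  push_cast
  ring_nf

/-- `Φ_ℂ = Φ` on the real axis. [folklore] -/
theorem UniversalFactor.deBruijnPhiC_ofReal (t : ℝ) :
    UniversalFactor.deBruijnPhiC (t : ℂ) = (deBruijnPhi t : ℂ) := by
  unfold UniversalFactor.deBruijnPhiC deBruijnPhi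
  rw [Complex.ofReal_tsum]
  exact tsum_congr fun n ↦ UniversalFactor.deBruijnPhiSummandC_ofReal n t

/-- Each complex summand is entire. [folklore] -/
theorem UniversalFactor.differentiable_deBruijnPhiSummandC (n : ℕ) :
    Differentiable ℂ (UniversalFactor.deBruijnPhiSummandC n) := by
  unfold UniversalFactor.deBruijnPhiSummandC
  fun_prop

/-- The open rectangle `|Re u| < R`, `|Im u| < π/8 − δ`. [folklore] -/
theorem UniversalFactor.isOpen_rect (R δ : ℝ) :
    IsOpen {u : ℂ | |u.re| < R ∧ |u.im| < Real.pi / 8 - δ} :=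
  (isOpen_lt (continuous_abs.comp Complex.continuous_re) continuous_const).inter
    (isOpen_lt (continuous_abs.comp Complex.continuous_im) continuous_const)

/-- On the rectangle, `Re e^{4u} ≥ e^{−4R} sin(4δ)`. [folklore] -/
theorem UniversalFactor.re_cexp_four_mul_ge {R δ : ℝ} (hδ : 0 < δ) (hδ' : δ < Real.pi / 8) {u : ℂ}
    (hu : |u.re| < R ∧ |u.im| < Real.pi / 8 - δ) :
    Real.exp (-(4 * R)) * Real.sin (4 * δ) ≤ (cexp (4 * u)).re := by
  rw [Complex.exp_re]
  have hre : (4 * u).re = 4 * u.re := by simp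
  have him : (4 * u).im = 4 * u.im := by simp
  rw [hre, him]
  have h1 : Real.exp (-(4 * R)) ≤ Real.exp (4 * u.re) :=
    Real.exp_le_exp.2 (by linarith [neg_abs_le u.re, hu.1])
  have h2 : Real.sin (4 * δ) ≤ Real.cos (4 * u.im) := by
    rw [← Real.cos_pi_div_two_sub, ← Real.cos_abs (4 * u.im)]
    apply Real.cos_le_cos_of_nonneg_of_le_pi (abs_nonneg _)
    · linarith [Real.pi_pos]
    · rw [abs_mul, abs_of_pos (by norm_num : (0:ℝ) < 4)]
      linarith [hu.2]
  have hsin : 0 ≤ Real.sin (4 * δ) :=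
    Real.sin_nonneg_of_nonneg_of_le_pi (by linarith) (by linarith [Real.pi_pos])
  exact mul_le_mul h1 h2 hsin (Real.exp_pos _).le

/-- Weierstrass bound for the summands on the rectangle. [folklore] -/
theorem UniversalFactor.norm_deBruijnPhiSummandC_le {R δ : ℝ} (hδ : 0 < δ) (hδ' : δ < Real.pi / 8)
    (n : ℕ) {u : ℂ} (hu : |u.re| < R ∧ |u.im| < Real.pi / 8 - δ) :
    ‖UniversalFactor.deBruijnPhiSummandC n u‖ ≤
      (2 * π ^ 2 * Real.exp (9 * R) + 3 * π * Real.exp (5 * R)) *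
        (((n : ℝ) + 1) ^ 4 * Real.exp (-(π * (Real.exp (-(4 * R)) * Real.sin (4 * δ)) * ((n : ℝ) + 1)))) := by
  set m : ℝ := (n : ℝ) + 1 with hm
  have hm1 : (1 : ℝ) ≤ m := by simp [hm]
  set c : ℝ := Real.exp (-(4 * R)) * Real.sin (4 * δ) with hc
  have hc0 : 0 ≤ c := by
    have : 0 ≤ Real.sin (4 * δ) :=
      Real.sin_nonneg_of_nonneg_of_le_pi (by linarith) (by linarith [Real.pi_pos])
    positivity
  have hmC : ((n : ℂ) + 1) = (m : ℂ) := by simp [hm]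
  have hnorm_m : ‖((n : ℂ) + 1)‖ = m := by
    rw [hmC, Complex.norm_real, Real.norm_eq_abs, abs_of_pos (by linarith)]
  -- the Gaussian factor
  have hG : ‖cexp (-(π * ((n : ℂ) + 1) ^ 2 * cexp (4 * u)))‖ ≤ Real.exp (-(π * c * m)) := by
    rw [Complex.norm_exp]
    apply Real.exp_le_exp.2
    have hcast : (π : ℂ) * ((n : ℂ) + 1) ^ 2 = ((π * m ^ 2 : ℝ) : ℂ) := by
      rw [hmC]; push_cast; ring
    rw [neg_re, hcast, Complex.re_ofReal_mul]
    have hre := UniversalFactor.re_cexp_four_mul_ge hδ hδ' hu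
    have h1 : π * m ^ 2 * c ≤ π * m ^ 2 * (cexp (4 * u)).re := by gcongr
    have h2 : π * c * m ≤ π * m ^ 2 * c := by
      have : m ≤ m ^ 2 := by nlinarith
      nlinarith [Real.pi_pos, mul_nonneg Real.pi_pos.le hc0]
    linarith
  -- the polynomial-exponential prefactor
  have hre9 : ‖cexp (9 * u)‖ ≤ Real.exp (9 * R) := by
    rw [Complex.norm_exp]; apply Real.exp_le_exp.2
    have : (9 * u).re = 9 * u.re := by simp
    rw [this]; linarith [le_abs_self u.re, hu.1]
  have hre5 : ‖cexp (5 * u)‖ ≤ Real.exp (5 * R) := by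
    rw [Complex.norm_exp]; apply Real.exp_le_exp.2
    have : (5 * u).re = 5 * u.re := by simp
    rw [this]; linarith [le_abs_self u.re, hu.1]
  have hP : ‖2 * (π : ℂ) ^ 2 * ((n : ℂ) + 1) ^ 4 * cexp (9 * u) -
      3 * π * ((n : ℂ) + 1) ^ 2 * cexp (5 * u)‖ ≤
      (2 * π ^ 2 * Real.exp (9 * R) + 3 * π * Real.exp (5 * R)) * m ^ 4 := by
    refine (norm_sub_le _ _).trans ?_
    have e1 : ‖2 * (π : ℂ) ^ 2 * ((n : ℂ) + 1) ^ 4 * cexp (9 * u)‖ = 2 * π ^ 2 * m ^ 4 * ‖cexp (9 * u)‖ := by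
      simp only [norm_mul, norm_pow, hnorm_m, Complex.norm_real, Real.norm_eq_abs,
        abs_of_pos Real.pi_pos, Complex.norm_ofNat]
    have e2 : ‖3 * (π : ℂ) * ((n : ℂ) + 1) ^ 2 * cexp (5 * u)‖ = 3 * π * m ^ 2 * ‖cexp (5 * u)‖ := by
      simp only [norm_mul, norm_pow, hnorm_m, Complex.norm_real, Real.norm_eq_abs,
        abs_of_pos Real.pi_pos, Complex.norm_ofNat]
    rw [e1, e2]
    have hm24 : m ^ 2 ≤ m ^ 4 := pow_le_pow_right₀ hm1 (by norm_num)
    have t1 : 2 * π ^ 2 * m ^ 4 * ‖cexp (9 * u)‖ ≤ 2 * π ^ 2 * m ^ 4 * Real.exp (9 * R) := by gcongr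
    have t2 : 3 * π * m ^ 2 * ‖cexp (5 * u)‖ ≤ 3 * π * m ^ 4 * Real.exp (5 * R) := by
      gcongr
    nlinarith [t1, t2]
  calc ‖UniversalFactor.deBruijnPhiSummandC n u‖
      = ‖2 * (π : ℂ) ^ 2 * ((n : ℂ) + 1) ^ 4 * cexp (9 * u) - 3 * π * ((n : ℂ) + 1) ^ 2 * cexp (5 * u)‖ *
          ‖cexp (-(π * ((n : ℂ) + 1) ^ 2 * cexp (4 * u)))‖ := by
        rw [UniversalFactor.deBruijnPhiSummandC, norm_mul]
    _ ≤ (2 * π ^ 2 * Real.exp (9 * R) + 3 * π * Real.exp (5 * R)) * m ^ 4 * Real.exp (-(π * c * m)) :=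
        mul_le_mul hP hG (norm_nonneg _) (by positivity)
    _ = _ := by rw [hc]; ring

/-- `Φ_ℂ` is holomorphic on each rectangle `|Re u| < R`, `|Im u| < π/8 − δ` (Weierstrass M-test,
`Complex.differentiableOn_tsum_of_summable_norm`). [folklore] -/
theorem UniversalFactor.differentiableOn_deBruijnPhiC_rect (R : ℝ) {δ : ℝ} (hδ : 0 < δ)
    (hδ' : δ < Real.pi / 8) :
    DifferentiableOn ℂ UniversalFactor.deBruijnPhiC {u : ℂ | |u.re| < R ∧ |u.im| < Real.pi / 8 - δ} := by
  have hc : 0 < π * (Real.exp (-(4 * R)) * Real.sin (4 * δ)) := by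
    have : 0 < Real.sin (4 * δ) := Real.sin_pos_of_pos_of_lt_pi (by linarith) (by linarith [Real.pi_pos])
    positivity
  have hsum := (summable_succ_pow_mul_exp_neg_mul 4 hc).mul_left
    (2 * π ^ 2 * Real.exp (9 * R) + 3 * π * Real.exp (5 * R))
  unfold UniversalFactor.deBruijnPhiC
  exact Complex.differentiableOn_tsum_of_summable_norm hsum
    (fun n ↦ (UniversalFactor.differentiable_deBruijnPhiSummandC n).differentiableOn)
    (UniversalFactor.isOpen_rect R δ)
    (fun n u hu ↦ UniversalFactor.norm_deBruijnPhiSummandC_le hδ hδ' n hu)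

/-- `Φ_ℂ` is complex differentiable at every point of the strip `|Im u| < π/8`. [folklore] -/
theorem UniversalFactor.differentiableAt_deBruijnPhiC {u : ℂ} (hu : |u.im| < Real.pi / 8) :
    DifferentiableAt ℂ UniversalFactor.deBruijnPhiC u := by
  set δ : ℝ := (Real.pi / 8 - |u.im|) / 2 with hδ
  have hδ0 : 0 < δ := by rw [hδ]; linarith
  have hδ' : δ < Real.pi / 8 := by
    rw [hδ]; linarith [abs_nonneg u.im, Real.pi_pos]
  have hmem : u ∈ {w : ℂ | |w.re| < |u.re| + 1 ∧ |w.im| < Real.pi / 8 - δ} := by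
    refine ⟨by linarith, ?_⟩
    show |u.im| < Real.pi / 8 - δ
    rw [hδ]; linarith
  exact (UniversalFactor.differentiableOn_deBruijnPhiC_rect (|u.re| + 1) hδ0 hδ').differentiableAt
    ((UniversalFactor.isOpen_rect _ _).mem_nhds hmem)

/-- The strip `|Im u| < π/8` is open. [folklore] -/
theorem UniversalFactor.isOpen_imStrip : IsOpen {u : ℂ | |u.im| < Real.pi / 8} :=
  isOpen_lt (continuous_abs.comp Complex.continuous_im) continuous_const

/-- `Φ_ℂ` is analytic on the strip `|Im u| < π/8`. [folklore] -/
theorem UniversalFactor.analyticOnNhd_deBruijnPhiC :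
    AnalyticOnNhd ℂ UniversalFactor.deBruijnPhiC {u : ℂ | |u.im| < Real.pi / 8} := by
  have h : DifferentiableOn ℂ UniversalFactor.deBruijnPhiC {u : ℂ | |u.im| < Real.pi / 8} :=
    fun u hu ↦ (UniversalFactor.differentiableAt_deBruijnPhiC hu).differentiableWithinAt
  exact h.analyticOnNhd UniversalFactor.isOpen_imStrip


/-! ## Fourier inversion on the real axis: `∫₀^∞ H_0(x) cos(tx) dx = (π/2) Φ(t)` -/

/-- `𝓕Φ(w) = 2 H_0(2πw)` (Pólya's representation `𝓕Φ(w) = ξ(½ + iπw)/4`, `fourier_deBruijnPhi`, and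
`H_0(z) = ξ(½ + iz/2)/8`). [folklore] -/
theorem UniversalFactor.fourier_deBruijnPhi_eq (w : ℝ) :
    𝓕 (fun u : ℝ ↦ (deBruijnPhi u : ℂ)) w = 2 * deBruijnH 0 ((2 * π * w : ℝ) : ℂ) := by
  rw [fourier_deBruijnPhi, deBruijnH_zero_eq_holds]
  have h : (1 / 2 + I * ((2 * π * w : ℝ) : ℂ) / 2 : ℂ) = 1 / 2 + ((π * w : ℝ) : ℂ) * I := by
    push_cast; ring
  rw [h]; ring

/-- `H_0` is integrable on the real line. [folklore] -/
theorem UniversalFactor.integrable_deBruijnH_zero_real :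
    Integrable (fun x : ℝ ↦ deBruijnH 0 (x : ℂ)) := by
  have hΞ := integrable_riemannXi_criticalLine
  have h : (fun x : ℝ ↦ deBruijnH 0 (x : ℂ)) = fun x ↦ riemannXi (1 / 2 + ↑((2⁻¹ : ℝ) * x) * I) / 8 := by
    funext x; rw [deBruijnH_zero_eq_holds]; congr 2; push_cast; ring
  rw [h]
  exact (hΞ.comp_mul_left' (by norm_num : (2⁻¹ : ℝ) ≠ 0)).div_const 8

/-- `x ↦ H_0(x) cos(tx)` is integrable on the real line. [folklore] -/
theorem UniversalFactor.integrable_deBruijnH_zero_mul_cos (t : ℝ) :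
    Integrable (fun x : ℝ ↦ deBruijnH 0 (x : ℂ) * Complex.cos (t * x)) := by
  have hH := UniversalFactor.integrable_deBruijnH_zero_real
  have hm : AEStronglyMeasurable (fun x : ℝ ↦ Complex.cos (t * x)) volume :=
    (Complex.continuous_cos.comp (continuous_const.mul Complex.continuous_ofReal)).aestronglyMeasurable
  have hb : ∀ x : ℝ, ‖Complex.cos (t * x)‖ ≤ 1 := fun x ↦ by
    rw [show (t : ℂ) * x = ((t * x : ℝ) : ℂ) by push_cast; ring, ← Complex.ofReal_cos, Complex.norm_real,
      Real.norm_eq_abs]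
    exact Real.abs_cos_le_one _
  simpa [mul_comm] using hH.bdd_mul hm (ae_of_all _ hb)

/-- **Fourier inversion at real frequencies**: `∫₀^∞ H_0(x) cos(tx) dx = (π/2) Φ(t)` for every real
`t` (Mathlib's `Continuous.fourierInv_fourier_eq` applied to `Φ`, whose transform `2H_0(2π·)` is
integrable; `Φ` and `H_0` are even). [cite: Titchmarsh1986, §10.1 eqs. (10.1.3)–(10.1.4)] -/
theorem UniversalFactor.integral_Ioi_deBruijnH_zero_mul_cos (t : ℝ) :
    ∫ x in Ioi (0:ℝ), deBruijnH 0 (x : ℂ) * Complex.cos (t * x) =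
      ((Real.pi / 2 : ℝ) : ℂ) * deBruijnPhi t := by
  set φ : ℝ → ℂ := fun u ↦ (deBruijnPhi u : ℂ) with hφ
  have hφi : Integrable φ := by simpa [hφ] using integrable_exp_mul_deBruijnPhi 0
  have hφc : Continuous φ := continuous_ofReal.comp continuous_deBruijnPhi
  have h𝓕 : 𝓕 φ = fun w : ℝ ↦ 2 * deBruijnH 0 ((2 * π * w : ℝ) : ℂ) :=
    funext UniversalFactor.fourier_deBruijnPhi_eq
  have hH := UniversalFactor.integrable_deBruijnH_zero_real
  have h𝓕i : Integrable (𝓕 φ) := by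
    rw [h𝓕]
    exact (hH.comp_mul_left' (by positivity : (2 * π : ℝ) ≠ 0)).const_mul 2
  have hinv : 𝓕⁻ (𝓕 φ) = φ := hφc.fourierInv_fourier_eq hφi h𝓕i
  -- inversion at `t` and at `-t`
  have e1 : φ t = ∫ v : ℝ, cexp (↑(-2 * π * v * -t) * I) • 𝓕 φ v := by
    conv_lhs => rw [← hinv]
    rw [fourierInv_eq_fourier_neg, fourier_real_eq_integral_exp_smul]
  have e2 : φ (-t) = ∫ v : ℝ, cexp (↑(-2 * π * v * t) * I) • 𝓕 φ v := by
    conv_lhs => rw [← hinv]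
    rw [fourierInv_eq_fourier_neg, neg_neg, fourier_real_eq_integral_exp_smul]
  have heven : φ (-t) = φ t := by simp only [hφ]; rw [deBruijnPhi_neg_holds]
  -- integrability of the two oscillatory integrands
  have hI : ∀ s : ℝ, Integrable fun v : ℝ ↦ cexp (↑(-2 * π * v * s) * I) • 𝓕 φ v := by
    intro s
    have hm : AEStronglyMeasurable (fun v : ℝ ↦ cexp (↑(-2 * π * v * s) * I)) volume := by
      refine (Complex.continuous_exp.comp ?_).aestronglyMeasurable
      fun_prop
    have hb : ∀ v : ℝ, ‖cexp (↑(-2 * π * v * s) * I)‖ ≤ 1 :=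
      fun v ↦ by rw [Complex.norm_exp_ofReal_mul_I]
    simpa [smul_eq_mul] using h𝓕i.bdd_mul hm (ae_of_all _ hb)
  -- add: `2 φ t = ∫ 2 cos(2π v t) 𝓕φ(v) dv`
  have hsum : 2 * φ t = ∫ v : ℝ, 2 * Complex.cos ((2 * π * v * t : ℝ)) * 𝓕 φ v := by
    rw [two_mul, show φ t + φ t = φ t + φ (-t) by rw [heven], e1, e2, ← integral_add (hI (-t)) (hI t)]
    refine integral_congr_ae (ae_of_all _ fun v ↦ ?_)
    simp only [smul_eq_mul]
    rw [← add_mul, Complex.two_cos]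
    congr 1
    push_cast
    try ring_nf
  -- substitute `x = 2πv`
  set g : ℝ → ℂ := fun x ↦ 2 * Complex.cos (t * x) * (2 * deBruijnH 0 (x : ℂ)) with hg
  have hsub : ∫ v : ℝ, 2 * Complex.cos ((2 * π * v * t : ℝ)) * 𝓕 φ v = ∫ v : ℝ, g (2 * π * v) := by
    refine integral_congr_ae (ae_of_all _ fun v ↦ ?_)
    simp only [hg, h𝓕]
    push_cast
    ring_nf
  have hcomp : ∫ v : ℝ, g (2 * π * v) = (((2 * π)⁻¹ : ℝ) : ℂ) * ∫ x : ℝ, g x := by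
    have h := Measure.integral_comp_mul_left g (2 * π)
    rw [abs_of_pos (by positivity : (0:ℝ) < (2 * π)⁻¹), Complex.real_smul] at h
    exact h
  -- the whole-line integral of `g` is `8 J`, `J = ∫₀^∞ H_0 cos(t·)`
  set f : ℝ → ℂ := fun x ↦ deBruijnH 0 (x : ℂ) * Complex.cos (t * x) with hf
  have hfi : Integrable f := UniversalFactor.integrable_deBruijnH_zero_mul_cos t
  have hfg : ∫ x : ℝ, g x = 4 * ∫ x : ℝ, f x := by
    rw [← integral_const_mul]
    refine integral_congr_ae (ae_of_all _ fun x ↦ ?_)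
    simp only [hg, hf]; ring
  have hfeven : ∀ x : ℝ, f (-x) = f x := by
    intro x
    simp only [hf]
    rw [Complex.ofReal_neg, deBruijnH_neg, mul_neg, Complex.cos_neg]
  have hsplit : ∫ x : ℝ, f x = 2 * ∫ x in Ioi (0:ℝ), f x := by
    have h1 : ∫ x : ℝ, f x = (∫ x in Iic (0:ℝ), f x) + ∫ x in Ioi (0:ℝ), f x := by
      rw [← setIntegral_union (Iic_disjoint_Ioi le_rfl) measurableSet_Ioi hfi.integrableOn
        hfi.integrableOn, Iic_union_Ioi, Measure.restrict_univ]
    have h2 : ∫ x in Iic (0:ℝ), f x = ∫ x in Ioi (0:ℝ), f x := by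
      rw [← neg_zero, ← integral_comp_neg_Ioi, neg_zero]
      exact setIntegral_congr_fun measurableSet_Ioi fun x _ ↦ hfeven x
    rw [h1, h2, two_mul]
  -- assemble
  have hπ : (π : ℂ) ≠ 0 := ofReal_ne_zero.mpr Real.pi_ne_zero
  have key : 2 * φ t = (((2 * π)⁻¹ : ℝ) : ℂ) * (4 * (2 * ∫ x in Ioi (0:ℝ), f x)) := by
    rw [hsum, hsub, hcomp, hfg, hsplit]
  have hJ : (∫ x in Ioi (0:ℝ), f x) = (π : ℂ) / 2 * φ t := by
    have h8 : (8 : ℂ) * (∫ x in Ioi (0:ℝ), f x) = 2 * π * (2 * φ t) := by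
      rw [key]; push_cast; field_simp; ring
    linear_combination h8 / 8
  rw [hJ]
  simp only [hφ]
  push_cast
  ring


end Summit.RiemannHypothesis.RiemannHypothesis.Theorems
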